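import Summits.HodgeConjecture.HodgeConjecture.Theorems.F0P3APacketMembersOfT5            -- ★ T5 V8 chain (kit: `memberCoeff`, `expansion`; reading) + the pattern file
import HarnessLib

/-!
# `F0P3RelParityOfT5Parity` — F2 part A: the PARITY ALGEBRA of the expansion coefficients of (14.6.3) (kit-free; theorems only)

Cell `pub/hodgecm-mathlib`, F0∕P2 ∕ P3, crux H413 (`stmt-HodgeConjecture-24833`); road «REL♯ ⟸ T5 at 𝔎₀» (desk F0P2-plan (g12) CENSUS `F0/P2/CENSUS-RELSHARP-T5.F0P2-plan-g12.md`,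
LEAD F0P3a-plan (g10) WORD T9-13 (2); pen F0P2-p02 (g9), census `F0/P2/p02/g9/CENSUS-F2-RelParityOfT5.F0P2p02g9.md`).  Consumed by part B ★-to-be `F0P3RelParityOfT5`
(the head `relSharpGuarded_of_T5`).  HONEST LABEL: HC_CM is proved only modulo the printed citations until rung 0 closes; this file is unconditional finite algebra on
★ `memberCoeff` ∕ ★ `expansion` (KitV6 §1.1) — no def, no instance, no notation, no named fact, no `sorry`.

THE ALGEBRA [Rogawski1990, §14.6 p. 238 l. 11 – p. 239 l. 4].  For a coordinate tuple `x = (x_ι, (x_v)_{v ∈ S})` all of whose entries are packet MEMBERS, the member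
coefficients are `m⁺ = 1` and `m⁻ = ε ∈ {±1}` (`ε = 1` at `πⁿ`, `−1` at `πˢ ≠ πⁿ`), so `E_ξ(x) = [cptXi]·½·(−1)^N·(ε_ι ∏_S ε_v + c(ξ))` (**`expansion_eq_of_mem`**); hence
`E_ξ(x) = 1` forces `ε_ι(x) · ∏_{v ∈ S} ε_v(x) = c(ξ)` (**`sign_eq_sgnG_of_expansion_eq_one`**).  For TWO member tuples whose signs agree with ONE constant and whose
`ι`-coefficients agree, `∏_S ε_v(x) ε_v(x′) = 1`, so the places `v ∈ S` with `ε_v(x) ≠ ε_v(x′)` — equivalently (members!) `x_v ≠ x′_v`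
(**`memberCoeff_neg_one_eq_iff_of_mem`**) — are EVEN in number (**`even_card_filter_ne_of_sign_eq`**).  This is the RELATIVE form of «`Card{v : π_v = πˢ} ≡ N`»
in which `N` and `c(ξ)` cancel.
-/

set_option autoImplicit false
set_option linter.dupNamespace false


noncomputable section

open NumberField IsDedekindDomain MeasureTheory
open scoped Matrix ComplexOrder BigOperators Classical

namespace Summit.HodgeConjecture.HodgeConjecture.Cruxes.H413.F0P3RelParityOfT5

open Literature.NumberTheory.Rogawski1990 Literature.NumberTheory.GaloisRepresentations
open Literature.NumberTheory.Automorphic Literature.NumberTheory.Automorphic.UnitaryGroup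
open Literature.NumberTheory.Automorphic.UnitaryGroup.CotangentForms
open Literature.RepresentationTheory.BorelWallach2000
open Literature.RepresentationTheory.KonnoKonno2007
open Summit.HodgeConjecture.HodgeConjecture.Cruxes.H413.F0P3InnerFormClassificationV6 (Gp Places LocS EqOff IsCot KcTrivial HasToken one_le_multiplicity)
open Summit.HodgeConjecture.HodgeConjecture.Cruxes.H413.F0P3InnerFormClassificationV6.ClassificationKit (coordS memberCoeff Adm)
open Summit.HodgeConjecture.HodgeConjecture.Cruxes.H413.F0P3InnerFormClassificationV8

/-! ## §2.1 Member coefficients on members -/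

/-- On a MEMBER the `(+1)`-coefficient is `1`. [cite: Rogawski1990, §14.6 p. 238] -/
theorem memberCoeff_one_of_mem {C : Type*} (Pk : LocalAPacket C) {x : C} (hx : x ∈ Pk.members) : memberCoeff Pk 1 x = 1 := by
  unfold memberCoeff
  rcases (LocalAPacket.mem_members_iff Pk x).1 hx with h | h
  · rw [if_pos h]
  · by_cases h' : x = Pk.πn
    · rw [if_pos h']
    · rw [if_neg h', if_pos h]

/-- On a MEMBER the `(−1)`-coefficient is `±1`. [cite: Rogawski1990, §14.6 p. 238] -/
theorem memberCoeff_neg_one_of_mem {C : Type*} (Pk : LocalAPacket C) {x : C} (hx : x ∈ Pk.members) :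
    memberCoeff Pk (-1) x = 1 ∨ memberCoeff Pk (-1) x = -1 := by
  unfold memberCoeff
  rcases (LocalAPacket.mem_members_iff Pk x).1 hx with h | h
  · exact Or.inl (by rw [if_pos h])
  · by_cases h' : x = Pk.πn
    · exact Or.inl (by rw [if_pos h'])
    · exact Or.inr (by rw [if_neg h', if_pos h])

/-- **Two members have the SAME `(−1)`-coefficient iff they are EQUAL** (`ε = 1` exactly at `πⁿ`, `ε = −1` exactly at `πˢ ≠ πⁿ`). [cite: Rogawski1990, §13.1 p. 199; §14.6 p. 238] -/
theorem memberCoeff_neg_one_eq_iff_of_mem {C : Type*} (Pk : LocalAPacket C) {x y : C} (hx : x ∈ Pk.members) (hy : y ∈ Pk.members) :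
    memberCoeff Pk (-1) x = memberCoeff Pk (-1) y ↔ x = y := by
  refine ⟨fun h => ?_, fun h => by rw [h]⟩
  unfold memberCoeff at h
  rcases (LocalAPacket.mem_members_iff Pk x).1 hx with hx' | hx' <;> rcases (LocalAPacket.mem_members_iff Pk y).1 hy with hy' | hy'
  · rw [hx', hy']
  · by_cases hyn : y = Pk.πn
    · rw [hx', hyn]
    · rw [if_pos hx', if_neg hyn, if_pos hy'] at h; norm_num at h
  · by_cases hxn : x = Pk.πn
    · rw [hxn, hy']
    · rw [if_neg hxn, if_pos hx', if_pos hy'] at h; norm_num at h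
  · by_cases hxn : x = Pk.πn
    · by_cases hyn : y = Pk.πn
      · rw [hxn, hyn]
      · rw [if_pos hxn, if_neg hyn, if_pos hy'] at h; norm_num at h
    · by_cases hyn : y = Pk.πn
      · rw [if_neg hxn, if_pos hx', if_pos hyn] at h; norm_num at h
      · exact Option.some_injective _ (hx'.symm.trans hy')

/-! ## §2.2 Products of signs -/

/-- A product of `±1`'s is `±1`. [folklore] -/
theorem prod_eq_one_or_eq_neg_one {ι : Type*} (s : Finset ι) (f : ι → ℚ) (hf : ∀ i ∈ s, f i = 1 ∨ f i = -1) :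
    ∏ i ∈ s, f i = 1 ∨ ∏ i ∈ s, f i = -1 := by
  have hsq : (∏ i ∈ s, f i) * (∏ i ∈ s, f i) = 1 := by
    rw [← Finset.prod_mul_distrib]
    refine Finset.prod_eq_one fun i hi => ?_
    rcases hf i hi with h | h <;> rw [h] <;> norm_num
  exact mul_self_eq_one_iff.1 hsq

/-- A product of `±1`'s equals `(−1)^{#{i | f i = −1}}`. [folklore] -/
theorem prod_eq_neg_one_pow_card_filter {ι : Type*} (s : Finset ι) (f : ι → ℚ) (hf : ∀ i ∈ s, f i = 1 ∨ f i = -1) :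
    ∏ i ∈ s, f i = (-1) ^ (s.filter fun i => f i = -1).card := by
  classical
  induction s using Finset.induction_on with
  | empty => simp
  | insert a s ha ih =>
    rw [Finset.prod_insert ha, Finset.filter_insert, ih fun i hi => hf i (Finset.mem_insert_of_mem hi)]
    rcases hf a (Finset.mem_insert_self a s) with h | h
    · rw [h, one_mul, if_neg (by norm_num)]
    · rw [h, if_pos rfl, Finset.card_insert_of_notMem (fun h' => ha (Finset.mem_filter.1 h').1), pow_succ]
      ring

/-- **If a product of `±1`'s is `1`, the number of `−1`'s is EVEN.** [folklore] -/
theorem even_card_filter_of_prod_eq_one {ι : Type*} (s : Finset ι) (f : ι → ℚ) (hf : ∀ i ∈ s, f i = 1 ∨ f i = -1) (h : ∏ i ∈ s, f i = 1) :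
    Even (s.filter fun i => f i = -1).card := by
  rw [prod_eq_neg_one_pow_card_filter s f hf] at h
  exact (neg_one_pow_eq_one_iff_even (by norm_num)).1 h

/-- **Two `±1`-valued functions whose pointwise product multiplies to `1` DIFFER at an even number of points.** [folklore] -/
theorem even_card_filter_ne_of_prod_mul_eq_one {ι : Type*} (s : Finset ι) (f g : ι → ℚ) (hf : ∀ i ∈ s, f i = 1 ∨ f i = -1)
    (hg : ∀ i ∈ s, g i = 1 ∨ g i = -1) (h : ∏ i ∈ s, (f i * g i) = 1) :
    Even (s.filter fun i => f i ≠ g i).card := by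
  have hfg : ∀ i ∈ s, f i * g i = 1 ∨ f i * g i = -1 := by
    intro i hi
    rcases hf i hi with h1 | h1 <;> rcases hg i hi with h2 | h2 <;> rw [h1, h2] <;> norm_num
  have heq : (s.filter fun i => f i ≠ g i) = s.filter fun i => f i * g i = -1 := by
    refine Finset.filter_congr fun i hi => ?_
    rcases hf i hi with h1 | h1 <;> rcases hg i hi with h2 | h2 <;> rw [h1, h2] <;> norm_num
  rw [heq]
  exact even_card_filter_of_prod_eq_one s _ hfg h

/-! ## §2.3 The expansion coefficient on a member tuple, and the sign it pins -/

section Kit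

variable {L : Type} [Field L] [NumberField L] [IsCMField L] {H : Matrix (Fin 3) (Fin 3) L} {ι : L →+* ℂ} {T : GL (Fin 3) ℂ}
  {hT : (T : Matrix (Fin 3) (Fin 3) ℂ)ᴴ * H.map ι * (T : Matrix (Fin 3) (Fin 3) ℂ) = Literature.Geometry.ComplexHyperbolic.BallModel.J}
  {μ : Measure (Gp L H).automorphicQuotient} [(Gp L H).IsAutomorphicMeasure μ] (𝔠 : ClassificationKit L H ι T hT μ)

/-- **`E_ξ(x)` ON A MEMBER TUPLE**: `E_ξ(x) = [cptXi ξ] · ½ · (−1)^N · (ε_ι(x) · ∏_S ε_v(x) + c(ξ))` with `ε := memberCoeff · (−1) ·` (the `(+1)`-coefficients are all `1`).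
[cite: Rogawski1990, §14.6 p. 238 ll. 11–18] -/
theorem expansion_eq_of_mem (ξ : OneDimAutRepH L) (S : Finset (Places L)) (x : LocS L H S) (hI : x.1 ∈ (𝔠.packInf ξ).members)
    (hF : ∀ v : ↥S, x.2 v ∈ (𝔠.packFin ξ v.1).members) :
    𝔠.expansion ξ S x = (if 𝔠.cptXi ξ then 1 else 0) * (1 / 2) * (-1) ^ 𝔠.N ξ *
      (memberCoeff (𝔠.packInf ξ) (-1) x.1 * ∏ v : ↥S, memberCoeff (𝔠.packFin ξ v.1) (-1) (x.2 v) + 𝔠.sgnG ξ) := by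
  unfold F0P3InnerFormClassificationV6.ClassificationKit.expansion
  rw [memberCoeff_one_of_mem _ hI, Finset.prod_eq_one (fun v _ => memberCoeff_one_of_mem _ (hF v)), one_mul, mul_one]

/-- **THE SIGN PINNED BY `E_ξ(x) = 1`**: on a member tuple with `c(ξ) = ±1`, `E_ξ(x) = 1` forces `ε_ι(x) · ∏_{v ∈ S} ε_v(x) = c(ξ)` (and `cptXi ξ`, and `(−1)^N = c(ξ)`).
(`[cpt]·½·(−1)^N·(a + c) = 1` with `a, c, (−1)^N ∈ {±1}` iff `[cpt] = 1` and `a = c = (−1)^N`.) [cite: Rogawski1990, §14.6 p. 238 l. −4 – p. 239 l. 4] -/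
theorem sign_eq_sgnG_of_expansion_eq_one (ξ : OneDimAutRepH L) (S : Finset (Places L)) (x : LocS L H S) (hI : x.1 ∈ (𝔠.packInf ξ).members)
    (hF : ∀ v : ↥S, x.2 v ∈ (𝔠.packFin ξ v.1).members) (hc : 𝔠.sgnG ξ = 1 ∨ 𝔠.sgnG ξ = -1) (hE : 𝔠.expansion ξ S x = 1) :
    memberCoeff (𝔠.packInf ξ) (-1) x.1 * ∏ v : ↥S, memberCoeff (𝔠.packFin ξ v.1) (-1) (x.2 v) = 𝔠.sgnG ξ := by
  rw [expansion_eq_of_mem 𝔠 ξ S x hI hF] at hE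
  have ha : memberCoeff (𝔠.packInf ξ) (-1) x.1 * ∏ v : ↥S, memberCoeff (𝔠.packFin ξ v.1) (-1) (x.2 v) = 1 ∨
      memberCoeff (𝔠.packInf ξ) (-1) x.1 * ∏ v : ↥S, memberCoeff (𝔠.packFin ξ v.1) (-1) (x.2 v) = -1 := by
    rcases memberCoeff_neg_one_of_mem _ hI with h1 | h1 <;>
      rcases prod_eq_one_or_eq_neg_one Finset.univ (fun v : ↥S => memberCoeff (𝔠.packFin ξ v.1) (-1) (x.2 v)) (fun v _ => memberCoeff_neg_one_of_mem _ (hF v))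
        with h2 | h2 <;> rw [h1, h2] <;> norm_num
  have hN : ((-1 : ℚ)) ^ 𝔠.N ξ = 1 ∨ ((-1 : ℚ)) ^ 𝔠.N ξ = -1 := neg_one_pow_eq_or ℚ _
  generalize memberCoeff (𝔠.packInf ξ) (-1) x.1 * ∏ v : ↥S, memberCoeff (𝔠.packFin ξ v.1) (-1) (x.2 v) = a at ha hE ⊢
  generalize ((-1 : ℚ)) ^ 𝔠.N ξ = e at hN hE
  generalize 𝔠.sgnG ξ = c at hc hE ⊢
  by_cases hcpt : 𝔠.cptXi ξ
  · rw [if_pos hcpt] at hE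
    rcases ha with rfl | rfl <;> rcases hc with rfl | rfl <;> rcases hN with rfl | rfl <;> norm_num at hE <;> norm_num
  · rw [if_neg hcpt] at hE
    norm_num at hE

/-- **TWO MEMBER TUPLES WITH `E = 1` IN ONE `(N, c, packInf, packFin)` AND EQUAL `ι`-COEFFICIENTS differ (as tuples over `S`) at an EVEN number of places.**
Stated for total coordinate functions `f f′ : Places → class` read on `S` (the shape `coordS S (cl P)` has). [cite: Rogawski1990, §14.6 Thm. 14.6.4 p. 238] -/
theorem even_card_filter_ne_of_expansion_eq_one (ξ : OneDimAutRepH L) (S : Finset (Places L)) (xI xI' : F0P3InnerFormClassificationV6.Cinf)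
    (f f' : ∀ v : Places L, IrrClass ((cmDatum L 3 H).Local v))
    (hI : xI ∈ (𝔠.packInf ξ).members) (hI' : xI' ∈ (𝔠.packInf ξ).members)
    (hF : ∀ v ∈ S, f v ∈ (𝔠.packFin ξ v).members) (hF' : ∀ v ∈ S, f' v ∈ (𝔠.packFin ξ v).members)
    (hc : 𝔠.sgnG ξ = 1 ∨ 𝔠.sgnG ξ = -1)
    (hE : 𝔠.expansion ξ S (xI, fun v => f v.1) = 1) (hE' : 𝔠.expansion ξ S (xI', fun v => f' v.1) = 1)
    (hιeq : memberCoeff (𝔠.packInf ξ) (-1) xI = memberCoeff (𝔠.packInf ξ) (-1) xI') :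
    Even (S.filter fun v => f v ≠ f' v).card := by
  have h1 := sign_eq_sgnG_of_expansion_eq_one 𝔠 ξ S (xI, fun v => f v.1) hI (fun v => hF v.1 v.2) hc hE
  have h2 := sign_eq_sgnG_of_expansion_eq_one 𝔠 ξ S (xI', fun v => f' v.1) hI' (fun v => hF' v.1 v.2) hc hE'
  simp only at h1 h2
  rw [hιeq] at h1
  have hι0 : memberCoeff (𝔠.packInf ξ) (-1) xI' ≠ 0 := by
    rcases memberCoeff_neg_one_of_mem _ hI' with h | h <;> rw [h] <;> norm_num
  -- the two sign products over `S` agree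
  have hprod : ∏ v : ↥S, memberCoeff (𝔠.packFin ξ v.1) (-1) (f v.1) = ∏ v : ↥S, memberCoeff (𝔠.packFin ξ v.1) (-1) (f' v.1) :=
    mul_left_cancel₀ hι0 (h1.trans h2.symm)
  -- so their pointwise product multiplies to `1`
  have hsq : ∏ v ∈ S.attach, (memberCoeff (𝔠.packFin ξ v.1) (-1) (f v.1) * memberCoeff (𝔠.packFin ξ v.1) (-1) (f' v.1)) = 1 := by
    rw [Finset.prod_mul_distrib]
    change (∏ v : ↥S, memberCoeff (𝔠.packFin ξ v.1) (-1) (f v.1)) * ∏ v : ↥S, memberCoeff (𝔠.packFin ξ v.1) (-1) (f' v.1) = 1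
    rw [hprod]
    rcases prod_eq_one_or_eq_neg_one Finset.univ (fun v : ↥S => memberCoeff (𝔠.packFin ξ v.1) (-1) (f' v.1)) (fun v _ => memberCoeff_neg_one_of_mem _ (hF' v.1 v.2))
      with h | h
    · change (∏ v : ↥S, memberCoeff (𝔠.packFin ξ v.1) (-1) (f' v.1)) = 1 at h; rw [h]; norm_num
    · change (∏ v : ↥S, memberCoeff (𝔠.packFin ξ v.1) (-1) (f' v.1)) = -1 at h; rw [h]; norm_num
  have heven := even_card_filter_ne_of_prod_mul_eq_one S.attach (fun v => memberCoeff (𝔠.packFin ξ v.1) (-1) (f v.1))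
    (fun v => memberCoeff (𝔠.packFin ξ v.1) (-1) (f' v.1)) (fun v _ => memberCoeff_neg_one_of_mem _ (hF v.1 v.2))
    (fun v _ => memberCoeff_neg_one_of_mem _ (hF' v.1 v.2)) hsq
  -- translate «different coefficient» into «different class» (members) and `S.attach` into `S`
  have hcard : (S.attach.filter fun v => memberCoeff (𝔠.packFin ξ v.1) (-1) (f v.1) ≠ memberCoeff (𝔠.packFin ξ v.1) (-1) (f' v.1)).card =
      (S.filter fun v => f v ≠ f' v).card := by
    have hfilt : (S.attach.filter fun v => memberCoeff (𝔠.packFin ξ v.1) (-1) (f v.1) ≠ memberCoeff (𝔠.packFin ξ v.1) (-1) (f' v.1)) =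
        S.attach.filter fun v => f v.1 ≠ f' v.1 := by
      refine Finset.filter_congr fun v _ => ?_
      rw [not_iff_not, memberCoeff_neg_one_eq_iff_of_mem _ (hF v.1 v.2) (hF' v.1 v.2)]
    rw [hfilt, Finset.filter_attach (fun v => f v ≠ f' v) S, Finset.card_map, Finset.card_attach]
  rw [hcard] at heven
  exact heven

/-- **KIT-FREE FORM**: two member tuples whose SIGNS `ε_ι · ∏_S ε_v` agree with ONE constant `c` and whose `ι`-coefficients agree differ at an even number of
places of `S` — the shape in which two kits sharing `(sgnG, packInf, packFin)` are compared. [cite: Rogawski1990, §14.6 Thm. 14.6.4 p. 238] -/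
theorem even_card_filter_ne_of_sign_eq (PkI : LocalAPacket F0P3InnerFormClassificationV6.Cinf) (Pk : ∀ v : Places L, CMLocalAPacket L H v)
    (S : Finset (Places L)) (xI xI' : F0P3InnerFormClassificationV6.Cinf) (f f' : ∀ v : Places L, IrrClass ((cmDatum L 3 H).Local v))
    (hI' : xI' ∈ PkI.members) (hF : ∀ v ∈ S, f v ∈ (Pk v).members) (hF' : ∀ v ∈ S, f' v ∈ (Pk v).members) (c : ℚ)
    (h1 : memberCoeff PkI (-1) xI * ∏ v : ↥S, memberCoeff (Pk v.1) (-1) (f v.1) = c)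
    (h2 : memberCoeff PkI (-1) xI' * ∏ v : ↥S, memberCoeff (Pk v.1) (-1) (f' v.1) = c)
    (hιeq : memberCoeff PkI (-1) xI = memberCoeff PkI (-1) xI') :
    Even (S.filter fun v => f v ≠ f' v).card := by
  rw [hιeq] at h1
  have hι0 : memberCoeff PkI (-1) xI' ≠ 0 := by
    rcases memberCoeff_neg_one_of_mem _ hI' with h | h <;> rw [h] <;> norm_num
  have hprod : ∏ v : ↥S, memberCoeff (Pk v.1) (-1) (f v.1) = ∏ v : ↥S, memberCoeff (Pk v.1) (-1) (f' v.1) :=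
    mul_left_cancel₀ hι0 (h1.trans h2.symm)
  have hsq : ∏ v ∈ S.attach, (memberCoeff (Pk v.1) (-1) (f v.1) * memberCoeff (Pk v.1) (-1) (f' v.1)) = 1 := by
    rw [Finset.prod_mul_distrib]
    change (∏ v : ↥S, memberCoeff (Pk v.1) (-1) (f v.1)) * ∏ v : ↥S, memberCoeff (Pk v.1) (-1) (f' v.1) = 1
    rw [hprod]
    rcases prod_eq_one_or_eq_neg_one Finset.univ (fun v : ↥S => memberCoeff (Pk v.1) (-1) (f' v.1)) (fun v _ => memberCoeff_neg_one_of_mem _ (hF' v.1 v.2))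
      with h | h
    · change (∏ v : ↥S, memberCoeff (Pk v.1) (-1) (f' v.1)) = 1 at h; rw [h]; norm_num
    · change (∏ v : ↥S, memberCoeff (Pk v.1) (-1) (f' v.1)) = -1 at h; rw [h]; norm_num
  have heven := even_card_filter_ne_of_prod_mul_eq_one S.attach (fun v => memberCoeff (Pk v.1) (-1) (f v.1))
    (fun v => memberCoeff (Pk v.1) (-1) (f' v.1)) (fun v _ => memberCoeff_neg_one_of_mem _ (hF v.1 v.2))
    (fun v _ => memberCoeff_neg_one_of_mem _ (hF' v.1 v.2)) hsq
  have hcard : (S.attach.filter fun v => memberCoeff (Pk v.1) (-1) (f v.1) ≠ memberCoeff (Pk v.1) (-1) (f' v.1)).card =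
      (S.filter fun v => f v ≠ f' v).card := by
    have hfilt : (S.attach.filter fun v => memberCoeff (Pk v.1) (-1) (f v.1) ≠ memberCoeff (Pk v.1) (-1) (f' v.1)) =
        S.attach.filter fun v => f v.1 ≠ f' v.1 := by
      refine Finset.filter_congr fun v _ => ?_
      rw [not_iff_not, memberCoeff_neg_one_eq_iff_of_mem _ (hF v.1 v.2) (hF' v.1 v.2)]
    rw [hfilt, Finset.filter_attach (fun v => f v ≠ f' v) S, Finset.card_map, Finset.card_attach]
  rw [hcard] at heven
  exact heven

end Kit


end Summit.HodgeConjecture.HodgeConjecture.Cruxes.H413.F0P3RelParityOfT5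

end
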